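import Literature.Probability.Percolation.KestenScalingFromSeparation
import Literature.Probability.Percolation.WernerOneArmStabilityFromTwoFacts
import Literature.Probability.Percolation.NearCriticalScaling
import HarnessLib

/-!
# Werner's one-arm stability below `L(p)` from near-critical four-arm separation (assembly, proofs only)

Topic `Literature/Probability/Percolation`; family `crit-perc`. PROOFS ONLY (no definition, no
named fact): the state of the discharge of the named fact `Werner2009_oneArm_nearCritical`
(`WernerCorrelationLength.lean`; W. Werner, *Lectures on two-dimensional critical percolation*,
IAS/Park City Math. Ser. 16 (2009), Lecture 6, §5, "Using differential inequalities for the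
one-arm event": `P_p(0 ↔ ∂Λ_n) ≍ P_{1/2}(0 ↔ ∂Λ_n)` uniformly for `n ≤ L(p)`; P. Nolin,
*Near-critical percolation in two dimensions*, EJP 13 (2008), Thm. 27, case `j = 1`; originally
H. Kesten, *Comm. Math. Phys.* 109 (1987), Thm. 1).

`WernerOneArmStabilityFromTwoFacts.lean` derives `Werner2009_oneArm_nearCritical` from the two
named facts `Werner2009_fourArm_quasiMult` (Werner, Cor. 6.2) and `Werner2009_pivotal_lowerBound`
(Werner, proof of Lemma 6.2, interior points). Both have since been PROVED in the tree from one
and the same explicitly displayed hypothesis — the comparability, uniformly below Werner's length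
`L(t, ε) = charLengthW ε t`, of the well-separated four-arm event `sepFourArm n N`
(`ArmSeparationFourArm.lean`) with the tree's four-arm probability `π̂_t(n, N) = fourArmProbAt t n N`
(Nolin 2008, Thm. 11 for `j = 4` [arXiv 0711.4948: Thm. 10]; Werner 2009, Prop. 6.1; Kesten 1987,
Lemmas 4–6): `Werner2009_fourArm_quasiMult_of_separation` (`NearCriticalFourArmQuasiMult.lean`) and
`Werner2009_pivotal_lowerBound_of_separation` (`PivotalLowerBoundFromSeparation.lean`). This file
records the two resulting routes to the fact, so that its discharge is ONE application away from
either of the two statements the fleet is proving: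

* `Werner2009_oneArm_nearCritical_of_separation` — **the fact from near-critical four-arm
  separation** (the same hypothesis, verbatim, as in `KestenScalingFromSeparation.lean`, where
  Werner's Lemmas 6.2–6.3 and Kesten's relation are derived from it);
* `Werner2009_oneArm_nearCritical_of_thm27_oneArm` — **the fact from Nolin's Thm. 27 for one arm**
  (`Nolin2008_thm27_oneArm`, `NearCriticalScaling.lean`, stated for every `ε ∈ (0, 1/2)` below
  Nolin's rhombus length `L_ε(p) = charLength ε p` and on both sides of `1/2`): Werner's length is
  dominated by Nolin's at a suitable level, `L(p, ε) ≤ L_{ε'}(p)` for `1/2 < p < 3/4`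
  (`charLengthW_le_charLength_of_gt`, `CharLengthWRSW.lean`, an RSW statement), so the `p > 1/2`
  half of Thm. 27 at level `ε'` is Werner's statement at level `ε`. (The converse reduction, of the
  `p > 1/2` half of `Nolin2008_thm27_oneArm` to this fact, is `NearCriticalScalingOneArmProofs.lean`.)

## References

* W. Werner, *Lectures on two-dimensional critical percolation*, IAS/Park City Math. Ser. 16
  (2009), Lecture 6, §4 (Prop. 6.1, Cor. 6.2), Lemma 6.2, §5 ("Using differential inequalities
  for the one-arm event"; arXiv 0710.0856, p. 65 of the lecture notes) [WernerPCMI2009].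
* P. Nolin, Near-critical percolation in two dimensions, *Electron. J. Probab.* 13 (2008)
  1562–1623, §3.1 (the lengths `L_ε`), Thm. 11, §6 Thm. 27 (arXiv 0711.4948: Thm. 10, Thm. 26)
  [Nolin2008].
* H. Kesten, Scaling relations for 2D-percolation, *Comm. Math. Phys.* 109 (1987) 109–156,
  Thm. 1, Lemmas 4–6 [KestenScalingCMP1987].

Tree: `Werner2009_oneArm_nearCritical_of_facts2` (`WernerOneArmStabilityFromTwoFacts.lean`),
`Werner2009_fourArm_quasiMult_of_separation` (`NearCriticalFourArmQuasiMult.lean`),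
`Werner2009_pivotal_lowerBound_of_separation` (`PivotalLowerBoundFromSeparation.lean`),
`Nolin2008_thm27_oneArm` (`NearCriticalScaling.lean`), `charLengthW_le_charLength_of_gt`
(`CharLengthWRSW.lean`). Mathlib: nothing beyond the imports of these files.
-/

namespace Literature.Probability.Percolation

open LatticeModels
open scoped unitInterval

/-- **`Werner2009_oneArm_nearCritical` from near-critical four-arm separation** (Werner 2009,
Lecture 6, §5: `P_p(0 ↔ ∂Λ_n) ≍ P_{1/2}(0 ↔ ∂Λ_n)` for `n ≤ L(p)`, through Cor. 6.2 and the lower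
bound of Lemma 6.2, both consequences of the arm-separation Prop. 6.1; Nolin 2008, Thm. 27 for
`j = 1` with Thm. 11). IF for every small `ε` there are `n₀`, a right neighbourhood
`[1/2, 1/2 + δ)` of `1/2` and `c > 0` with `c · π̂_t(n, N) ≤ P_t(sepFourArm n N)` for `n₀ ≤ n`,
`2n ≤ N`, `N ≤ L(t, ε)` if `t > 1/2`, THEN the named fact holds:
`Werner2009_oneArm_nearCritical_of_facts2` applied to `Werner2009_fourArm_quasiMult_of_separation`
and `Werner2009_pivotal_lowerBound_of_separation`. [cite: WernerPCMI2009, Lecture 6, §5 ("Using differential inequalities for the one-arm event") with Prop. 6.1, Cor. 6.2 and Lemma 6.2] [cite: Nolin2008, Thm. 27 (j = 1) with Thm. 11 (arXiv 0711.4948: Thm. 26, Thm. 10)] -/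
theorem Werner2009_oneArm_nearCritical_of_separation
    (hsep : ∃ ε₁ > (0 : ℝ), ∀ ⦃ε : ℝ⦄, 0 < ε → ε < ε₁ →
      ∃ n₀ : ℕ, ∃ δ > (0 : ℝ), ∃ c > (0 : ℝ),
        ∀ t : unitInterval, 1 / 2 ≤ (t : ℝ) → (t : ℝ) < 1 / 2 + δ →
          ∀ n N : ℕ, n₀ ≤ n → 2 * n ≤ N → (1 / 2 < (t : ℝ) → N ≤ charLengthW ε t) →
            c * fourArmProbAt t n N ≤ (triSitePercolation t).real (sepFourArm n N)) :
    Werner2009_oneArm_nearCritical :=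
  Werner2009_oneArm_nearCritical_of_facts2 (Werner2009_fourArm_quasiMult_of_separation hsep)
    (Werner2009_pivotal_lowerBound_of_separation hsep)

/-- **`Werner2009_oneArm_nearCritical` from Nolin's Thm. 27 for one arm** (Nolin 2008, §6.1,
Thm. 27 [arXiv 0711.4948: Thm. 26], `j = 1`, "uniformly in `p` … and `n ≤ N ≤ L(p)`", with
`P̂' = P_{1/2}`; Werner 2009, Lecture 6, §5). Werner's length at level `ε` is at most Nolin's
rhombus length at a level `ε' = ε'(ε) ∈ (0, 1/2)` for `1/2 < p < 3/4`
(`charLengthW_le_charLength_of_gt`), so the two-sided comparison of `Nolin2008_thm27_oneArm` at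
level `ε'`, restricted to `1/2 < p < 1/2 + min(δ, 1/4)`, is Werner's statement at level `ε` (for
every `ε > 0`; the threshold `ε₁ = 1` is arbitrary). [cite: Nolin2008, §6.1, Thm. 27, case j = 1 (arXiv 0711.4948: Thm. 26)] [cite: WernerPCMI2009, Lecture 6, §5 (display: P_p(0 ↔ ∂Λ_n) ≍ P_{1/2}(0 ↔ ∂Λ_n) for n ≤ L(p))] -/
theorem Werner2009_oneArm_nearCritical_of_thm27_oneArm (h : Nolin2008_thm27_oneArm) :
    Werner2009_oneArm_nearCritical := by
  refine ⟨1, one_pos, fun ε hε _ => ?_⟩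
  obtain ⟨ε', hε', hε'2, hLen⟩ := charLengthW_le_charLength_of_gt hε
  obtain ⟨δ, hδ, c, hc, C, hb⟩ := h hε' hε'2
  refine ⟨min δ (1 / 4), lt_min hδ (by norm_num), c, hc, C, fun p hp1 hp2 N hN => ?_⟩
  have hpδ : (p : ℝ) < 1 / 2 + δ := hp2.trans_le (by gcongr; exact min_le_left _ _)
  have hp34 : (p : ℝ) < 3 / 4 := by
    have : (p : ℝ) < 1 / 2 + 1 / 4 := hp2.trans_le (by gcongr; exact min_le_right _ _)
    linarith
  have hne : (p : ℝ) ≠ 1 / 2 := ne_of_gt hp1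
  have habs : |(p : ℝ) - 1 / 2| < δ := by
    rw [abs_sub_lt_iff]; constructor <;> linarith
  exact hb p hne habs N (hN.trans (hLen p hp1 hp34))

end Literature.Probability.Percolation
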